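import Mathlib

/-!
# Square test rows (solo-informed notes, Part II §7.11 (16.6)(D))

For a prime `𝔮` that is not narrowly principal the Eisenstein depth is read through the Hecke
operator `T(𝔮²) = T(𝔮)² − N𝔮·S(𝔮)` (trivial character: `S(𝔮) = 1`).  Writing the `T(𝔮)`-eigenvalue of the
congruent form as `a = 1 + N + u` with `u = a − σ₁(𝔮)`, the `T(𝔮²)`-residue is governed by the exact identity
below: `a² − N − σ₁(𝔮²) = u·(2(1 + N) + u)`, so its valuation equals that of `u` whenever `2(1 + N𝔮)` is a unit,
and to first order the normalised residue of the square row is `2(1 + N𝔮)` times that of `𝔮`.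
-/

namespace Summit.Langlands.Langlands.Theorems

/-- Exact identity behind the square rows: with `σ₁(𝔮²) = 1 + N + N²` and `a = 1 + N + u`,
`a² − N − σ₁(𝔮²) = u (2(1+N) + u)`. -/
theorem soloInformed_squareRow_identity {R : Type*} [CommRing R] (N u : R) :
    (1 + N + u) ^ 2 - N - (1 + N + N ^ 2) = u * (2 * (1 + N) + u) := by
  ring

/-- First-order form: over the dual numbers (`t² = 0`), if `a = 1 + N + t r` then the square-row residue is
`t · (2(1+N) r)` — the factor `2(1 + N𝔮)` used in (16.6)(D). -/
theorem soloInformed_squareRow_firstOrder {R : Type*} [CommRing R] (N r t : R) (ht : t ^ 2 = 0) :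
    (1 + N + t * r) ^ 2 - N - (1 + N + N ^ 2) = t * (2 * (1 + N) * r) := by
  have h : (1 + N + t * r) ^ 2 - N - (1 + N + N ^ 2) = t * (2 * (1 + N) * r) + t ^ 2 * r ^ 2 := by ring
  rw [h, ht]; ring

/-- Valuation-style corollary in the form used: if the residue lies in a PRIME ideal `P` not containing
`2(1+N) + u` then `u ∈ P`, and conversely. -/
theorem soloInformed_squareRow_mem_iff {R : Type*} [CommRing R] (N u : R) (P : Ideal R) (hP : P.IsPrime)
    (hunit : 2 * (1 + N) + u ∉ P) :
    (1 + N + u) ^ 2 - N - (1 + N + N ^ 2) ∈ P ↔ u ∈ P := by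
  rw [soloInformed_squareRow_identity]
  constructor
  · intro h
    rcases hP.mem_or_mem h with hu | h2
    · exact hu
    · exact absurd h2 hunit
  · intro hu; exact P.mul_mem_right _ hu

end Summit.Langlands.Langlands.Theorems
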